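import Literature.Probability.RandomMatrix.TwoQubitSeparabilityVolumes
import Literature.Probability.RandomMatrix.TwoQubitSeparabilityVolumesQubitFibreProofs
import HarnessLib

/-!
# Two-qubit separability probability: reduction to the central fibre
# (Zhang–Jiang–Xie 2025, proof of Theorem 6.12; Lovas–Andai 2017, Corollary 2)

Proofs companion of `TwoQubitSeparabilityVolumes.lean` (the statements file; theorems only here).

## What is proved

`HuongKhoi2024_qubit_separability_probability_holds : HuongKhoi2024_qubit_separability_probability`
(the discharge of the named fact of the statements file: the two-qubit Hilbert–Schmidt
PPT-to-total volume ratio is `8/33`), obtained as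

`HuongKhoi2024_qubit_separability_probability_of_fibre :
  ZhangJiangXie2025_qubit_fibre_separability_probability →
    HuongKhoi2024_qubit_separability_probability`

(proved in this file) applied to `ZhangJiangXie2025_qubit_fibre_separability_probability_holds`
(the central-fibre value `8/33`, proved in the sibling
`TwoQubitSeparabilityVolumesQubitFibreProofs.lean`). The reduction is the step
"`P_sep^{(2×2)} = P_sep^{(2×2)}(0)`" of the printed proof of [ZhangJiangXie2025, Thm. 6.12]
(read: arXiv:2507.02369, §6.1–6.2, Props. 6.5–6.10, Thms. 6.8, 6.12): the Hilbert–Schmidt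
(= entry Lebesgue, see the statements file) PPT-to-total volume ratio of ALL two-qubit density
matrices equals the ratio on the fibre `D⁰` of states whose reduced state (sum of the diagonal
blocks) is `½·1₂`, where PPT is `λ_max(ρ) ≤ ½`. What remains of
Theorem 6.12 after this reduction is exactly the central-fibre value `8/33` (Props. 6.7, 6.10:
unitary-orbit volumes and Duistermaat–Heckman densities in the source), which is the named fact
`ZhangJiangXie2025_qubit_fibre_separability_probability` of the statements file, discharged
(by an elementary computation) in `TwoQubitSeparabilityVolumesQubitFibreProofs.lean`.

(History: the reduction was first landed here as p46520; the file was then unknowingly replaced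
by the rebit seat's file of the same name, re-homed since in
`TwoQubitSeparabilityVolumesRebitFullProofs.lean`, and reduced to a placeholder; this version
restores the p46520 content verbatim and appends the final discharge.)

## Proof architecture (following the source)

* Thm. 6.8 (= [LovasAndai2017, Cor. 2], the Milz–Strunz invariance), mechanism: for a reduced
  state `D = P Pᴴ` with `P` invertible, `ρ ↦ (1 ⊗ √2 P) ρ (1 ⊗ √2 P)ᴴ` is a linear bijection from
  the central fibre onto the fibre over `D` preserving `ρ ≽ 0` and commuting with the partial
  transpose on the first factor; in the fibre coordinates `x ∈ ℝ¹²` it is a linear map `L` with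
  `det L ≠ 0`, so both fibre volumes scale by `|det L|` (`Measure.addHaar_preimage_linearMap`):
  `fibre_volume_transport`, `fibre_ratio`.
* Prop. 6.9: on the central fibre `ρ^Γ = (σ_y ⊗ 1)(½·1 − ρ)(σ_y ⊗ 1)ᴴ`, so
  `ρ^Γ ≽ 0 ⟺ ½·1 − ρ ≽ 0`: `posSemidef_fibrePT_iff`.
* Prop. 6.6 (disintegration): the entry chart `y ∈ ℝ¹⁵` is a measure-preserving image of
  `(x, d) ∈ ℝ¹² × ℝ³` (a coordinate permutation and a shear), `d` = the three coordinates of the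
  reduced state; Fubini (`Measure.prod_apply_symm`) and the a.e.-constant fibre ratio give the
  claim, the exceptional reduced states `det D = 0` forming a Lebesgue-null round sphere (the
  Bloch sphere): `measurePreserving_fibreChart`, `volume_blochSphere_eq_zero`, final assembly.

All matrices are handled in `2 × 2` block form through `Matrix.fromBlocks` and the reindexing
`finSumFinEquiv : Fin 2 ⊕ Fin 2 ≃ Fin 4`; the local notations `Ψ[x, d]` (inverse chart), `Xm[x]`,
`Zm[x]`, `Dm[d]` (blocks), `crd[H, Z]` (block coordinates), `Uy` (`σ_y ⊗ 1`) are file-local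
abbreviations only (no new definitions).

## References

* [ZhangJiangXie2025] L. Zhang, X. Jiang, B. Xie, QIC 25 (2025) 598–632, §6 (Props. 6.5–6.10,
  Thms. 6.8, 6.12). arXiv:2507.02369.
* [LovasAndai2017] A. Lovas, A. Andai, J. Phys. A 50 (2017) 295303, Corollary 2.
  arXiv:1610.01410.
* [HuongKhoi2024] H. T. Huong, V. T. Khoi, J. Phys. A 57 (2024) 445304 (the `8/33` theorem).
-/

noncomputable section

open MeasureTheory Matrix
open scoped ENNReal ComplexOrder Matrix MatrixOrder

namespace Literature.Probability.RandomMatrix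

section Notation

/-! ### File-local notation: charts and blocks -/

-- inverse chart: fibre coordinates `x ∈ ℝ¹²` and reduced-state coordinates `d ∈ ℝ³` ↦ entry
-- coordinates `y ∈ ℝ¹⁵`
local notation "Ψ[" x ", " d "]" =>
  (![x 0, x 1, x 2, x 3, d 0 - x 0, d 1 - x 2, d 2 - x 3, x 4, x 5, x 6, x 7, x 8, x 9, x 10, x 11] :
    Fin 15 → ℝ)

local notation "Xm[" x "]" =>
  (!![((x 0 : ℝ) : ℂ), (⟨x 2, x 3⟩ : ℂ); (⟨x 2, -(x 3)⟩ : ℂ), ((x 1 : ℝ) : ℂ)] : Matrix (Fin 2) (Fin 2) ℂ)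

local notation "Zm[" x "]" =>
  (!![(⟨x 4, x 5⟩ : ℂ), (⟨x 6, x 7⟩ : ℂ); (⟨x 8, x 9⟩ : ℂ), (⟨x 10, x 11⟩ : ℂ)] :
    Matrix (Fin 2) (Fin 2) ℂ)

local notation "Dm[" d "]" =>
  (!![((d 0 : ℝ) : ℂ), (⟨d 1, d 2⟩ : ℂ); (⟨d 1, -(d 2)⟩ : ℂ), ((1 - d 0 : ℝ) : ℂ)] :
    Matrix (Fin 2) (Fin 2) ℂ)

-- coordinates of a pair (Hermitian `H`, arbitrary `Z`) of `2 × 2` blocks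
local notation "crd[" H ", " Z "]" =>
(![Complex.re (H 0 0), Complex.re (H 1 1), Complex.re (H 0 1), Complex.im (H 0 1),
     Complex.re (Z 0 0), Complex.im (Z 0 0), Complex.re (Z 0 1), Complex.im (Z 0 1),
     Complex.re (Z 1 0), Complex.im (Z 1 0), Complex.re (Z 1 1), Complex.im (Z 1 1)] : Fin 12 → ℝ)

local notation "e4" => (finSumFinEquiv : Fin 2 ⊕ Fin 2 ≃ Fin 4)

-- the `σ_y ⊗ 1`-type unitary (up to the reindexing `Fin 2 ⊕ Fin 2 ≃ Fin 4`)
local notation "Uy" =>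
  (Matrix.reindex e4 e4 (Matrix.fromBlocks (0 : Matrix (Fin 2) (Fin 2) ℂ)
    (-(Complex.I • (1 : Matrix (Fin 2) (Fin 2) ℂ))) (Complex.I • 1) 0))

namespace HuongKhoi2024

/-! ### Block form of the charts; Prop. 6.9 -/

/-- Block form of the central-fibre chart: `qubitFibreMatrix x = [[X, Z], [Zᴴ, ½·1 − X]]` (blocks
indexed by the first tensor factor, `Fin 2 ⊕ Fin 2 ≃ Fin 4`). [folklore] -/
theorem qubitFibreMatrix_blocks (x : Fin 12 → ℝ) :
    qubitFibreMatrix x =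
      Matrix.reindex e4 e4
        (Matrix.fromBlocks Xm[x] Zm[x] (Zm[x])ᴴ ((2 : ℂ)⁻¹ • (1 : Matrix (Fin 2) (Fin 2) ℂ) - Xm[x])) := by
  ext i j
  fin_cases i <;> fin_cases j <;>
    simp [qubitFibreMatrix, Matrix.reindex_apply, Matrix.fromBlocks, finSumFinEquiv,
      Fin.addCases, Matrix.conjTranspose, Complex.ext_iff]

/-- Block form of `½·1 − ρ` on the central fibre: `[[½·1 − X, −Z], [−Zᴴ, X]]`. [folklore] -/
theorem half_sub_qubitFibreMatrix_blocks (x : Fin 12 → ℝ) :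
    (2 : ℂ)⁻¹ • (1 : Matrix (Fin 4) (Fin 4) ℂ) - qubitFibreMatrix x =
      Matrix.reindex e4 e4
        (Matrix.fromBlocks ((2 : ℂ)⁻¹ • (1 : Matrix (Fin 2) (Fin 2) ℂ) - Xm[x]) (-Zm[x]) (-(Zm[x])ᴴ) Xm[x]) := by
  ext i j
  fin_cases i <;> fin_cases j <;>
    simp [qubitFibreMatrix, Matrix.reindex_apply, Matrix.fromBlocks, finSumFinEquiv,
      Fin.addCases, Matrix.conjTranspose, Complex.ext_iff]

/-- The `σ_y ⊗ 1` congruence swaps the diagonal blocks and negates the off-diagonal ones: `U [[P, Q],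
[R, S]] Uᴴ = [[S, −R], [−Q, P]]`. [folklore] -/
theorem sigmaY_conj (P Q R S : Matrix (Fin 2) (Fin 2) ℂ) :
    Uy * Matrix.reindex e4 e4 (Matrix.fromBlocks P Q R S) * (Uy)ᴴ =
      Matrix.reindex e4 e4 (Matrix.fromBlocks S (-R) (-Q) P) := by
  simp only [Matrix.reindex_apply, Matrix.conjTranspose_submatrix, Matrix.fromBlocks_conjTranspose,
    Matrix.submatrix_mul_equiv, Matrix.fromBlocks_multiply]
  simp [smul_smul]

/-- `(σ_y ⊗ 1)² = 1`. [folklore] -/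
theorem sigmaY_mul_self : Uy * Uy = 1 := by
  simp only [Matrix.reindex_apply, Matrix.submatrix_mul_equiv, Matrix.fromBlocks_multiply]
  simp [smul_smul, Matrix.fromBlocks_one, Matrix.submatrix_one_equiv]

/-- `σ_y ⊗ 1` is invertible. [folklore] -/
theorem isUnit_sigmaY : IsUnit Uy := IsUnit.of_mul_eq_one _ sigmaY_mul_self

/-- **Prop. 6.9 in coordinates** (Zhang–Jiang–Xie 2025, after Huong–Khoi 2024): on the central fibre
(reduced state `½·1`) the partial transpose `ρ^Γ = [[X, Zᴴ], [Z, ½·1 − X]]` is unitarily congruent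
(by `σ_y ⊗ 1`) to `½·1 − ρ`, hence `ρ^Γ ≽ 0 ⟺ ½·1 − ρ ≽ 0` (`⟺ λ_max(ρ) ≤ ½`). [cite: ZhangJiangXie2025, Proposition 6.9] -/
theorem posSemidef_fibrePT_iff (x : Fin 12 → ℝ) :
    (Matrix.reindex e4 e4 (Matrix.fromBlocks Xm[x] (Zm[x])ᴴ Zm[x]
        ((2 : ℂ)⁻¹ • (1 : Matrix (Fin 2) (Fin 2) ℂ) - Xm[x]))).PosSemidef ↔
      ((2 : ℂ)⁻¹ • (1 : Matrix (Fin 4) (Fin 4) ℂ) - qubitFibreMatrix x).PosSemidef := by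
  have h := sigmaY_conj ((2 : ℂ)⁻¹ • (1 : Matrix (Fin 2) (Fin 2) ℂ) - Xm[x]) (-Zm[x]) (-(Zm[x])ᴴ) Xm[x]
  simp only [neg_neg] at h
  rw [half_sub_qubitFibreMatrix_blocks, ← h]
  have key := Matrix.IsUnit.posSemidef_star_right_conjugate_iff
    (x := Matrix.reindex e4 e4 (Matrix.fromBlocks ((2 : ℂ)⁻¹ • (1 : Matrix (Fin 2) (Fin 2) ℂ) - Xm[x])
      (-Zm[x]) (-(Zm[x])ᴴ) Xm[x])) isUnit_sigmaY
  rw [Matrix.star_eq_conjTranspose] at key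
  exact key

/-- The diagonal blocks of a positive semidefinite block matrix are positive semidefinite. [folklore] -/
theorem posSemidef_diag_blocks {X Z W Y : Matrix (Fin 2) (Fin 2) ℂ}
    (h : (Matrix.reindex e4 e4 (Matrix.fromBlocks X Z W Y)).PosSemidef) :
    X.PosSemidef ∧ Y.PosSemidef := by
  constructor
  · convert h.submatrix (fun i => e4 (Sum.inl i)) using 1
    ext i j; simp [Matrix.reindex_apply]
  · convert h.submatrix (fun i => e4 (Sum.inr i)) using 1
    ext i j; simp [Matrix.reindex_apply]

/-- Reading the coordinates of a Hermitian `2 × 2` block back gives the block. [folklore] -/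
theorem Xm_readback (H Z : Matrix (Fin 2) (Fin 2) ℂ) (hH : H.IsHermitian) :
    Xm[crd[H, Z]] = H := by
  have h00 := hH.apply 0 0
  have h11 := hH.apply 1 1
  have h10 := hH.apply 1 0
  rw [Complex.star_def, Complex.conj_eq_iff_im] at h00 h11
  ext i j
  fin_cases i <;> fin_cases j
  · simp [Complex.ext_iff, h00]
  · simp
  · simp [← h10, Complex.ext_iff]
  · simp [Complex.ext_iff, h11]

/-- Reading the coordinates of an arbitrary `2 × 2` block back gives the block. [folklore] -/
theorem Zm_readback (H Z : Matrix (Fin 2) (Fin 2) ℂ) : Zm[crd[H, Z]] = Z := by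
  ext i j
  fin_cases i <;> fin_cases j <;> simp

/-- The coordinate map is a left inverse of the chart `x ↦ (X, Z)`. [folklore] -/
theorem crd_Xm_Zm (x : Fin 12 → ℝ) : crd[Xm[x], Zm[x]] = x := by
  ext i
  fin_cases i <;> rfl

/-- The `X`-block of the chart is Hermitian. [folklore] -/
theorem isHermitian_Xm (x : Fin 12 → ℝ) : (Xm[x]).IsHermitian := by
  refine Matrix.IsHermitian.ext fun i j => ?_
  fin_cases i <;> fin_cases j <;> simp [Complex.ext_iff]

/-- The `X`-block is additive in the coordinates. [folklore] -/
theorem Xm_add (x y : Fin 12 → ℝ) : Xm[x + y] = Xm[x] + Xm[y] := by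
  ext i j
  fin_cases i <;> fin_cases j <;> simp [Complex.ext_iff]
  ring

/-- The `Z`-block is additive in the coordinates. [folklore] -/
theorem Zm_add (x y : Fin 12 → ℝ) : Zm[x + y] = Zm[x] + Zm[y] := by
  ext i j
  fin_cases i <;> fin_cases j <;> simp [Complex.ext_iff]

/-- The `X`-block is homogeneous in the coordinates. [folklore] -/
theorem Xm_smul (c : ℝ) (x : Fin 12 → ℝ) : Xm[c • x] = (c : ℂ) • Xm[x] := by
  ext i j
  fin_cases i <;> fin_cases j <;> simp [Complex.ext_iff]

/-- The `Z`-block is homogeneous in the coordinates. [folklore] -/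
theorem Zm_smul (c : ℝ) (x : Fin 12 → ℝ) : Zm[c • x] = (c : ℂ) • Zm[x] := by
  ext i j
  fin_cases i <;> fin_cases j <;> simp [Complex.ext_iff]

/-- The coordinate map is additive. [folklore] -/
theorem crd_add (H H' Z Z' : Matrix (Fin 2) (Fin 2) ℂ) :
    crd[H + H', Z + Z'] = crd[H, Z] + crd[H', Z'] := by
  ext i
  fin_cases i <;> simp

/-- The coordinate map is (real-)homogeneous. [folklore] -/
theorem crd_smul (c : ℝ) (H Z : Matrix (Fin 2) (Fin 2) ℂ) :
    crd[(c : ℂ) • H, (c : ℂ) • Z] = c • crd[H, Z] := by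
  ext i
  fin_cases i <;> simp

/-- Positive real scalar multiples do not change positive semidefiniteness. [folklore] -/
theorem posSemidef_real_smul_iff {n : Type*} [Fintype n] {c : ℝ} (hc : 0 < c)
    (M : Matrix n n ℂ) : ((c : ℂ) • M).PosSemidef ↔ M.PosSemidef := by
  have key : ∀ (a : ℝ), 0 < a → ∀ N : Matrix n n ℂ, N.PosSemidef → ((a : ℂ) • N).PosSemidef := by
    intro a ha N hN
    exact hN.smul (Complex.zero_le_real.mpr ha.le)
  refine ⟨fun h => ?_, key c hc M⟩
  have := key c⁻¹ (inv_pos.mpr hc) _ h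
  rwa [smul_smul, ← Complex.ofReal_mul, inv_mul_cancel₀ hc.ne', Complex.ofReal_one, one_smul] at this

/-- Block form of the entry chart restricted to the fibre over the reduced state `D(d) = [[d0, d1 + d2
i], [d1 − d2 i, 1 − d0]]` (obtained by summing the diagonal blocks): `twoQubitMatrix (Ψ x d) =
[[X, Z], [Zᴴ, D(d) − X]]`. [folklore] -/
theorem twoQubitMatrix_blocks (x : Fin 12 → ℝ) (d : Fin 3 → ℝ) :
    twoQubitMatrix Ψ[x, d] =
      Matrix.reindex e4 e4 (Matrix.fromBlocks Xm[x] Zm[x] (Zm[x])ᴴ (Dm[d] - Xm[x])) := by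
  ext i j
  fin_cases i <;> fin_cases j <;>
    simp [twoQubitMatrix, Matrix.reindex_apply, Matrix.fromBlocks, finSumFinEquiv,
      Fin.addCases, Matrix.conjTranspose, Complex.ext_iff] <;> ring

/-- Block form of the partial transpose on a fibre: `[[X, Zᴴ], [Z, D(d) − X]]`. [folklore] -/
theorem twoQubitMatrixPT_blocks (x : Fin 12 → ℝ) (d : Fin 3 → ℝ) :
    twoQubitMatrixPT Ψ[x, d] =
      Matrix.reindex e4 e4 (Matrix.fromBlocks Xm[x] (Zm[x])ᴴ Zm[x] (Dm[d] - Xm[x])) := by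
  ext i j
  fin_cases i <;> fin_cases j <;>
    simp [twoQubitMatrixPT, Matrix.reindex_apply, Matrix.fromBlocks, finSumFinEquiv,
      Fin.addCases, Matrix.conjTranspose, Complex.ext_iff] <;> ring

/-- Congruence by the block-diagonal lift `1 ⊗ A = A ⊕ A` acts blockwise: `(A ⊕ A)[[X, Z], [W, Y]](A ⊕
A)ᴴ = [[AXAᴴ, AZAᴴ], [AWAᴴ, AYAᴴ]]` (in particular it commutes with the partial transpose on the
first factor). [folklore] -/
theorem blockDiag_conj (A X Z W Y : Matrix (Fin 2) (Fin 2) ℂ) :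
    Matrix.reindex e4 e4 (Matrix.fromBlocks A 0 0 A) *
        Matrix.reindex e4 e4 (Matrix.fromBlocks X Z W Y) *
        (Matrix.reindex e4 e4 (Matrix.fromBlocks A 0 0 A))ᴴ =
      Matrix.reindex e4 e4
        (Matrix.fromBlocks (A * X * Aᴴ) (A * Z * Aᴴ) (A * W * Aᴴ) (A * Y * Aᴴ)) := by
  simp only [Matrix.reindex_apply, Matrix.conjTranspose_submatrix, Matrix.fromBlocks_conjTranspose,
    Matrix.submatrix_mul_equiv, Matrix.fromBlocks_multiply]
  simp [Matrix.mul_assoc]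

/-- The block-diagonal lift `P ⊕ P` of an invertible `P` is invertible. [folklore] -/
theorem isUnit_blockDiag {P : Matrix (Fin 2) (Fin 2) ℂ} (hP : IsUnit P) :
    IsUnit (Matrix.reindex e4 e4 (Matrix.fromBlocks P 0 0 P)) := by
  obtain ⟨Q, hQ⟩ := hP.exists_right_inv
  refine IsUnit.of_mul_eq_one (Matrix.reindex e4 e4 (Matrix.fromBlocks Q 0 0 Q)) ?_
  simp only [Matrix.reindex_apply, Matrix.submatrix_mul_equiv, Matrix.fromBlocks_multiply]
  simp [hQ, Matrix.fromBlocks_one, Matrix.submatrix_one_equiv]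

/-- **Fibre transport** (the mechanism of Lovas–Andai 2017, Corollary 2 = Zhang–Jiang–Xie 2025,
Theorem 6.8, `ρ ↦ (1 ⊗ A) ρ (1 ⊗ A)ᴴ`): if `P Pᴴ = D(d)` with `P` invertible, the linear change of
fibre coordinates `(X, Z) ↦ (2 P X Pᴴ, 2 P Z Pᴴ)` maps the central fibre onto the fibre over
`D(d)`, matching the bodies `ρ ≽ 0` and their PPT parts (`ρ^Γ ≽ 0`, on the central fibre spelled
`½·1 − ρ ≽ 0` by Prop. 6.9); hence both fibre volumes over `D(d)` are the same constant (Jacobian)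
multiple of the central ones. [cite: LovasAndai2017, Corollary 2 (proof)] -/
theorem fibre_volume_transport (d : Fin 3 → ℝ) (P : Matrix (Fin 2) (Fin 2) ℂ) (hP : IsUnit P)
    (hPD : P * Pᴴ = Dm[d]) :
    ∃ c : ℝ≥0∞, c ≠ 0 ∧ c ≠ ∞ ∧
      volume {x : Fin 12 → ℝ | (qubitFibreMatrix x).PosSemidef} =
        c * volume {x : Fin 12 → ℝ | (twoQubitMatrix Ψ[x, d]).PosSemidef} ∧
      volume {x : Fin 12 → ℝ | (qubitFibreMatrix x).PosSemidef ∧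
          ((2 : ℂ)⁻¹ • (1 : Matrix (Fin 4) (Fin 4) ℂ) - qubitFibreMatrix x).PosSemidef} =
        c * volume {x : Fin 12 → ℝ | (twoQubitMatrix Ψ[x, d]).PosSemidef ∧
          (twoQubitMatrixPT Ψ[x, d]).PosSemidef} := by
  -- the linear change of coordinates
  let L : (Fin 12 → ℝ) →ₗ[ℝ] (Fin 12 → ℝ) :=
    { toFun := fun x => crd[(2 : ℂ) • (P * Xm[x] * Pᴴ), (2 : ℂ) • (P * Zm[x] * Pᴴ)]
      map_add' := by
        intro x y
        rw [Xm_add, Zm_add, Matrix.mul_add, Matrix.add_mul, Matrix.mul_add, Matrix.add_mul,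
          smul_add, smul_add, crd_add]
      map_smul' := by
        intro c x
        rw [Xm_smul, Zm_smul, Matrix.mul_smul, Matrix.smul_mul, Matrix.mul_smul, Matrix.smul_mul,
          smul_comm (2 : ℂ) (c : ℂ), smul_comm (2 : ℂ) (c : ℂ), crd_smul]
        rfl }
  have hLapp : ∀ x, L x = crd[(2 : ℂ) • (P * Xm[x] * Pᴴ), (2 : ℂ) • (P * Zm[x] * Pᴴ)] :=
    fun x => rfl
  have hherm : ∀ x : Fin 12 → ℝ, ((2 : ℂ) • (P * Xm[x] * Pᴴ)).IsHermitian := by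
    intro x
    have h1 : (P * Xm[x] * Pᴴ).IsHermitian :=
      Matrix.isHermitian_mul_mul_conjTranspose _ (isHermitian_Xm x)
    unfold Matrix.IsHermitian at h1 ⊢
    rw [Matrix.conjTranspose_smul, h1]
    simp
  have hXL : ∀ x, Xm[L x] = (2 : ℂ) • (P * Xm[x] * Pᴴ) := fun x => by
    rw [hLapp]; exact Xm_readback _ _ (hherm x)
  have hZL : ∀ x, Zm[L x] = (2 : ℂ) • (P * Zm[x] * Pᴴ) := fun x => by
    rw [hLapp]; exact Zm_readback _ _
  -- the block-diagonal lift
  have hCunit := isUnit_blockDiag hP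
  have hPH : IsUnit Pᴴ := by simpa [Matrix.star_eq_conjTranspose] using hP.star
  -- matrix identities
  have hsm : ∀ A : Matrix (Fin 2 ⊕ Fin 2) (Fin 2 ⊕ Fin 2) ℂ,
      (2 : ℂ) • A.submatrix (e4).symm (e4).symm = ((2 : ℂ) • A).submatrix (e4).symm (e4).symm :=
    fun A => rfl
  have hM : ∀ x, twoQubitMatrix Ψ[L x, d] =
      (2 : ℂ) • (Matrix.reindex e4 e4 (Matrix.fromBlocks P 0 0 P) * qubitFibreMatrix x *
        (Matrix.reindex e4 e4 (Matrix.fromBlocks P 0 0 P))ᴴ) := by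
    intro x
    rw [twoQubitMatrix_blocks, qubitFibreMatrix_blocks, blockDiag_conj, hXL, hZL,
      Matrix.reindex_apply, Matrix.reindex_apply, hsm, Matrix.fromBlocks_smul]
    congr 1
    rw [Matrix.fromBlocks_inj]
    refine ⟨rfl, rfl, ?_, ?_⟩
    · rw [Matrix.conjTranspose_smul, Matrix.conjTranspose_mul, Matrix.conjTranspose_mul,
        Matrix.conjTranspose_conjTranspose, Matrix.mul_assoc]
      simp
    · rw [Matrix.mul_sub, Matrix.sub_mul, smul_sub, Matrix.mul_smul, Matrix.smul_mul, Matrix.mul_one,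
        hPD, smul_smul]
      norm_num
  have hMPT : ∀ x, twoQubitMatrixPT Ψ[L x, d] =
      (2 : ℂ) • (Matrix.reindex e4 e4 (Matrix.fromBlocks P 0 0 P) *
        Matrix.reindex e4 e4 (Matrix.fromBlocks Xm[x] (Zm[x])ᴴ Zm[x]
          ((2 : ℂ)⁻¹ • (1 : Matrix (Fin 2) (Fin 2) ℂ) - Xm[x])) *
        (Matrix.reindex e4 e4 (Matrix.fromBlocks P 0 0 P))ᴴ) := by
    intro x
    rw [twoQubitMatrixPT_blocks, blockDiag_conj, hXL, hZL,
      Matrix.reindex_apply, Matrix.reindex_apply, hsm, Matrix.fromBlocks_smul]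
    congr 1
    rw [Matrix.fromBlocks_inj]
    refine ⟨rfl, ?_, rfl, ?_⟩
    · rw [Matrix.conjTranspose_smul, Matrix.conjTranspose_mul, Matrix.conjTranspose_mul,
        Matrix.conjTranspose_conjTranspose, Matrix.mul_assoc]
      simp
    · rw [Matrix.mul_sub, Matrix.sub_mul, smul_sub, Matrix.mul_smul, Matrix.smul_mul, Matrix.mul_one,
        hPD, smul_smul]
      norm_num
  -- positivity is transported
  have h2 : ∀ M : Matrix (Fin 4) (Fin 4) ℂ, ((2 : ℂ) • M).PosSemidef ↔ M.PosSemidef := fun M => by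
    simpa using posSemidef_real_smul_iff two_pos M
  have hS : ∀ x, (twoQubitMatrix Ψ[L x, d]).PosSemidef ↔ (qubitFibreMatrix x).PosSemidef := by
    intro x
    rw [hM, h2]
    have key := Matrix.IsUnit.posSemidef_star_right_conjugate_iff (x := qubitFibreMatrix x) hCunit
    rwa [Matrix.star_eq_conjTranspose] at key
  have hT : ∀ x, (twoQubitMatrixPT Ψ[L x, d]).PosSemidef ↔
      ((2 : ℂ)⁻¹ • (1 : Matrix (Fin 4) (Fin 4) ℂ) - qubitFibreMatrix x).PosSemidef := by
    intro x
    rw [hMPT, h2, ← posSemidef_fibrePT_iff]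
    have key := Matrix.IsUnit.posSemidef_star_right_conjugate_iff
      (x := Matrix.reindex e4 e4 (Matrix.fromBlocks Xm[x] (Zm[x])ᴴ Zm[x]
          ((2 : ℂ)⁻¹ • (1 : Matrix (Fin 2) (Fin 2) ℂ) - Xm[x]))) hCunit
    rwa [Matrix.star_eq_conjTranspose] at key
  have hpre1 : {x : Fin 12 → ℝ | (qubitFibreMatrix x).PosSemidef} =
      L ⁻¹' {x | (twoQubitMatrix Ψ[x, d]).PosSemidef} := by
    ext x
    simp only [Set.mem_setOf_eq, Set.mem_preimage]
    exact (hS x).symm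
  have hpre2 : {x : Fin 12 → ℝ | (qubitFibreMatrix x).PosSemidef ∧
      ((2 : ℂ)⁻¹ • (1 : Matrix (Fin 4) (Fin 4) ℂ) - qubitFibreMatrix x).PosSemidef} =
      L ⁻¹' {x | (twoQubitMatrix Ψ[x, d]).PosSemidef ∧ (twoQubitMatrixPT Ψ[x, d]).PosSemidef} := by
    ext x
    simp only [Set.mem_setOf_eq, Set.mem_preimage]
    exact (and_congr (hS x) (hT x)).symm
  -- `L` is invertible
  have hinj : Function.Injective L := by
    intro x y hxy
    have hX : Xm[L x] = Xm[L y] := by rw [hxy]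
    have hZ : Zm[L x] = Zm[L y] := by rw [hxy]
    rw [hXL, hXL] at hX
    rw [hZL, hZL] at hZ
    have hX' : Xm[x] = Xm[y] :=
      (hP.mul_right_inj).mp ((hPH.mul_left_inj).mp (smul_right_injective _ two_ne_zero hX))
    have hZ' : Zm[x] = Zm[y] :=
      (hP.mul_right_inj).mp ((hPH.mul_left_inj).mp (smul_right_injective _ two_ne_zero hZ))
    rw [← crd_Xm_Zm x, ← crd_Xm_Zm y, hX', hZ']
  have hdet : LinearMap.det L ≠ 0 := by
    intro h0
    have hlt := LinearMap.bot_lt_ker_of_det_eq_zero h0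
    rw [LinearMap.ker_eq_bot.mpr hinj] at hlt
    exact lt_irrefl _ hlt
  refine ⟨ENNReal.ofReal |(LinearMap.det L)⁻¹|, ?_, ENNReal.ofReal_ne_top, ?_, ?_⟩
  · simpa using hdet
  · rw [hpre1, MeasureTheory.Measure.addHaar_preimage_linearMap volume hdet]
  · rw [hpre2, MeasureTheory.Measure.addHaar_preimage_linearMap volume hdet]

/-- **Constant fibre ratio** (Zhang–Jiang–Xie 2025, Theorem 6.8, after Lovas–Andai 2017, Cor. 2, and
Milz–Strunz): given the central fibre ratio `8/33`, the fibre over every reduced state `D(d)` with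
`det D(d) ≠ 0` has PPT-to-total volume ratio `8/33` (cross-multiplied; if `D(d)` is not positive
semidefinite the fibre is empty and both sides vanish). [cite: ZhangJiangXie2025, Theorem 6.8] -/
theorem fibre_ratio (hX : ZhangJiangXie2025_qubit_fibre_separability_probability)
    (d : Fin 3 → ℝ) (hd : d 0 * (1 - d 0) - d 1 ^ 2 - d 2 ^ 2 ≠ 0) :
    33 * volume {x : Fin 12 → ℝ | (twoQubitMatrix Ψ[x, d]).PosSemidef ∧
        (twoQubitMatrixPT Ψ[x, d]).PosSemidef} =
      8 * volume {x : Fin 12 → ℝ | (twoQubitMatrix Ψ[x, d]).PosSemidef} := by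
  by_cases hD : (Dm[d]).PosSemidef
  · have hdet : (Dm[d]).det ≠ 0 := by
      rw [Matrix.det_fin_two_of]
      intro h
      apply hd
      have := congrArg Complex.re h
      simp at this
      linear_combination this
    obtain ⟨B, hB⟩ := CStarAlgebra.nonneg_iff_eq_star_mul_self.mp hD.nonneg
    have hdetB : IsUnit (star B) := by
      rw [Matrix.isUnit_iff_isUnit_det, isUnit_iff_ne_zero]
      intro h0
      apply hdet
      rw [hB, Matrix.det_mul, h0, zero_mul]
    obtain ⟨c, hc0, hctop, h1, h2⟩ := fibre_volume_transport d (star B) hdetB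
      (by rw [hB, Matrix.star_eq_conjTranspose, Matrix.conjTranspose_conjTranspose])
    have hX' : 33 * volume {x : Fin 12 → ℝ | (qubitFibreMatrix x).PosSemidef ∧
        ((2 : ℂ)⁻¹ • (1 : Matrix (Fin 4) (Fin 4) ℂ) - qubitFibreMatrix x).PosSemidef} =
        8 * volume {x : Fin 12 → ℝ | (qubitFibreMatrix x).PosSemidef} := hX
    rw [h1, h2, mul_left_comm (33 : ℝ≥0∞), mul_left_comm (8 : ℝ≥0∞)] at hX'
    exact (ENNReal.mul_right_inj hc0 hctop).mp hX'
  · have hempty : ∀ x : Fin 12 → ℝ, ¬ (twoQubitMatrix Ψ[x, d]).PosSemidef := by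
      intro x hx
      rw [twoQubitMatrix_blocks] at hx
      obtain ⟨h1, h2⟩ := posSemidef_diag_blocks hx
      apply hD
      simpa using h1.add h2
    simp [hempty]

/-- The cone of positive semidefinite complex matrices is closed. [folklore] -/
theorem isClosed_setOf_posSemidef (n : Type*) [Fintype n] [DecidableEq n] :
    IsClosed {M : Matrix n n ℂ | M.PosSemidef} := by
  have hset : {M : Matrix n n ℂ | M.PosSemidef} =
      {M | Mᴴ = M} ∩ ⋂ v : n → ℂ, ((fun M : Matrix n n ℂ => star v ⬝ᵥ (M *ᵥ v)) ⁻¹' {z | 0 ≤ z}) := by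
    ext M
    simp only [Set.mem_setOf_eq, Set.mem_inter_iff, Set.mem_iInter, Set.mem_preimage,
      Matrix.posSemidef_iff_dotProduct_mulVec]
    rfl
  have hC : IsClosed {z : ℂ | 0 ≤ z} := by
    have : {z : ℂ | 0 ≤ z} = Complex.re ⁻¹' Set.Ici 0 ∩ Complex.im ⁻¹' {0} := by
      ext z
      simp [Complex.le_def, eq_comm]
    rw [this]
    exact (isClosed_Ici.preimage Complex.continuous_re).inter
      ((isClosed_singleton).preimage Complex.continuous_im)
  rw [hset]
  refine IsClosed.inter (isClosed_eq (continuous_id.matrix_conjTranspose) continuous_id)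
    (isClosed_iInter fun v => hC.preimage ?_)
  fun_prop

/-- The chart `twoQubitMatrix` is continuous. [folklore] -/
theorem continuous_twoQubitMatrix : Continuous twoQubitMatrix := by
  refine continuous_pi fun i => continuous_pi fun j => ?_
  fin_cases i <;> fin_cases j <;> simp [twoQubitMatrix, Complex.mk_eq_add_mul_I] <;> fun_prop

/-- The chart `twoQubitMatrixPT` is continuous. [folklore] -/
theorem continuous_twoQubitMatrixPT : Continuous twoQubitMatrixPT := by
  refine continuous_pi fun i => continuous_pi fun j => ?_
  fin_cases i <;> fin_cases j <;> simp [twoQubitMatrixPT, Complex.mk_eq_add_mul_I] <;> fun_prop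

/-- continuity of the inverse chart `(x, d) ↦ y`. [folklore] -/
theorem continuous_fibreChart :
    Continuous fun p : (Fin 12 → ℝ) × (Fin 3 → ℝ) => Ψ[p.1, p.2] := by
  refine continuous_pi fun i => ?_
  fin_cases i <;> simp <;> fun_prop

/-- The singular reduced states `det D(d) = 0` form a Lebesgue-null set (a round sphere, the
Bloch sphere). [folklore] -/
theorem volume_blochSphere_eq_zero :
    volume {d : Fin 3 → ℝ | d 0 * (1 - d 0) - d 1 ^ 2 - d 2 ^ 2 = 0} = 0 := by
  have hsub : {d : Fin 3 → ℝ | d 0 * (1 - d 0) - d 1 ^ 2 - d 2 ^ 2 = 0} ⊆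
      (WithLp.toLp 2) ⁻¹' Metric.sphere
        (WithLp.toLp 2 (![1 / 2, 0, 0] : Fin 3 → ℝ) : EuclideanSpace ℝ (Fin 3)) (1 / 2) := by
    intro d hd
    simp only [Set.mem_setOf_eq] at hd
    rw [Set.mem_preimage, Metric.mem_sphere, EuclideanSpace.dist_eq, Fin.sum_univ_three]
    simp only [Matrix.cons_val_zero, Matrix.cons_val_one, Matrix.cons_val, Real.dist_eq, sq_abs]
    rw [show (d 0 - 1 / 2) ^ 2 + (d 1 - 0) ^ 2 + (d 2 - 0) ^ 2 = (1 / 2) ^ 2 by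
      linear_combination (-1 : ℝ) * hd]
    exact Real.sqrt_sq (by norm_num)
  refine measure_mono_null hsub ?_
  rw [(PiLp.volume_preserving_toLp (Fin 3)).measure_preimage
    Metric.isClosed_sphere.measurableSet.nullMeasurableSet]
  exact Measure.addHaar_sphere volume _ _

/-- The chart `y ↦ (x, d)` (fibre coordinates, reduced-state coordinates) preserves Lebesgue
measure: it is a coordinate permutation followed by a shear. [folklore] -/
theorem measurePreserving_fibreChart :
    MeasurePreserving (fun y : Fin 15 → ℝ =>
      ((![y 0, y 1, y 2, y 3, y 7, y 8, y 9, y 10, y 11, y 12, y 13, y 14] : Fin 12 → ℝ),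
        (![y 0 + y 4, y 2 + y 5, y 3 + y 6] : Fin 3 → ℝ))) volume volume := by
  let f : Fin 12 ⊕ Fin 3 ≃ Fin 15 :=
    { toFun := Sum.elim ![0, 1, 2, 3, 7, 8, 9, 10, 11, 12, 13, 14] ![4, 5, 6]
      invFun := ![Sum.inl 0, Sum.inl 1, Sum.inl 2, Sum.inl 3, Sum.inr 0, Sum.inr 1, Sum.inr 2,
        Sum.inl 4, Sum.inl 5, Sum.inl 6, Sum.inl 7, Sum.inl 8, Sum.inl 9, Sum.inl 10, Sum.inl 11]
      left_inv := fun i => by rcases i with i | i <;> fin_cases i <;> rfl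
      right_inv := fun i => by fin_cases i <;> rfl }
  have hg1 := (volume_measurePreserving_piCongrLeft (fun _ : Fin 15 => ℝ) f).symm
  have hg2 := volume_measurePreserving_sumPiEquivProdPi (fun _ : Fin 12 ⊕ Fin 3 => ℝ)
  let sh : (Fin 12 → ℝ) × (Fin 3 → ℝ) → (Fin 12 → ℝ) × (Fin 3 → ℝ) := fun p =>
    (p.1, (![p.1 0, p.1 2, p.1 3] : Fin 3 → ℝ) + p.2)
  have hsh : MeasurePreserving sh volume volume := by
    have hc : Continuous fun p : (Fin 12 → ℝ) × (Fin 3 → ℝ) =>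
        (![p.1 0, p.1 2, p.1 3] : Fin 3 → ℝ) + p.2 := by
      refine Continuous.add (continuous_pi fun i => ?_) continuous_snd
      fin_cases i <;> simp <;> fun_prop
    have := (MeasurePreserving.id (volume : Measure (Fin 12 → ℝ))).skew_product
      (g := fun x u => (![x 0, x 2, x 3] : Fin 3 → ℝ) + u) hc.measurable
      (ae_of_all _ fun x => map_add_left_eq_self volume _)
    exact this
  have heq : (fun y : Fin 15 → ℝ =>
      ((![y 0, y 1, y 2, y 3, y 7, y 8, y 9, y 10, y 11, y 12, y 13, y 14] : Fin 12 → ℝ),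
        (![y 0 + y 4, y 2 + y 5, y 3 + y 6] : Fin 3 → ℝ))) =
      sh ∘ (MeasurableEquiv.sumPiEquivProdPi (fun _ : Fin 12 ⊕ Fin 3 => ℝ)) ∘
        (MeasurableEquiv.piCongrLeft (fun _ : Fin 15 => ℝ) f).symm := by
    funext y
    refine Prod.ext ?_ ?_
    · funext i
      fin_cases i <;> rfl
    · funext j
      fin_cases j <;> rfl
  rw [heq]
  exact hsh.comp (hg2.comp hg1)

end HuongKhoi2024

open HuongKhoi2024 in
/-- **Two-qubit separability probability from the central fibre** (Zhang–Jiang–Xie 2025, proof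
of Theorem 6.12: "`P_sep^{(2×2)} = P_sep^{(2×2)}(0)`", assembled from Theorem 6.8 = Lovas–Andai 2017,
Corollary 2 (the PPT-to-total volume ratio of a fibre does not depend on the reduced state),
Proposition 6.6 (disintegration of the Hilbert–Schmidt = Lebesgue volume over the reduced state,
here Fubini over the three reduced-state coordinates, the singular reduced states being a null
sphere) and Proposition 6.9 (on the central fibre PPT ⟺ `λ_max(ρ) ≤ ½`)). The remaining input of
the printed proof, the central fibre ratio `f(0) / vol_HS(D⁰) = 8/33` (Propositions 6.7 and 6.10),
is exactly the named fact `ZhangJiangXie2025_qubit_fibre_separability_probability`, taken here as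
the hypothesis. [cite: ZhangJiangXie2025, Theorem 6.12 (proof), with Theorem 6.8 and Propositions 6.6, 6.9] -/
theorem HuongKhoi2024_qubit_separability_probability_of_fibre
    (hX : ZhangJiangXie2025_qubit_fibre_separability_probability) :
    HuongKhoi2024_qubit_separability_probability := by
  classical
  have hΦ := measurePreserving_fibreChart
  set Φ := (fun y : Fin 15 → ℝ =>
      ((![y 0, y 1, y 2, y 3, y 7, y 8, y 9, y 10, y 11, y 12, y 13, y 14] : Fin 12 → ℝ),
        (![y 0 + y 4, y 2 + y 5, y 3 + y 6] : Fin 3 → ℝ))) with hΦdef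
  have hΦΨ : ∀ y : Fin 15 → ℝ, Ψ[(Φ y).1, (Φ y).2] = y := by
    intro y
    ext i
    fin_cases i <;> simp [hΦdef]
  set S := {p : (Fin 12 → ℝ) × (Fin 3 → ℝ) | (twoQubitMatrix Ψ[p.1, p.2]).PosSemidef} with hSdef
  set T := {p : (Fin 12 → ℝ) × (Fin 3 → ℝ) | (twoQubitMatrix Ψ[p.1, p.2]).PosSemidef ∧
    (twoQubitMatrixPT Ψ[p.1, p.2]).PosSemidef} with hTdef
  have hSmeas : MeasurableSet S :=
    ((isClosed_setOf_posSemidef (Fin 4)).preimage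
      (continuous_twoQubitMatrix.comp continuous_fibreChart)).measurableSet
  have hTmeas : MeasurableSet T :=
    (((isClosed_setOf_posSemidef (Fin 4)).preimage
      (continuous_twoQubitMatrix.comp continuous_fibreChart)).inter
      ((isClosed_setOf_posSemidef (Fin 4)).preimage
      (continuous_twoQubitMatrixPT.comp continuous_fibreChart))).measurableSet
  have h1 : {y : Fin 15 → ℝ | (twoQubitMatrix y).PosSemidef} = Φ ⁻¹' S := by
    ext y
    simp only [hSdef, Set.mem_setOf_eq, Set.mem_preimage, hΦΨ]
  have h2 : {y : Fin 15 → ℝ | (twoQubitMatrix y).PosSemidef ∧ (twoQubitMatrixPT y).PosSemidef} =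
      Φ ⁻¹' T := by
    ext y
    simp only [hTdef, Set.mem_setOf_eq, Set.mem_preimage, hΦΨ]
  unfold HuongKhoi2024_qubit_separability_probability
  rw [h2, h1, hΦ.measure_preimage hSmeas.nullMeasurableSet,
    hΦ.measure_preimage hTmeas.nullMeasurableSet, Measure.volume_eq_prod,
    Measure.prod_apply_symm hSmeas, Measure.prod_apply_symm hTmeas,
    ← lintegral_const_mul' _ _ (by norm_num), ← lintegral_const_mul' _ _ (by norm_num)]
  refine lintegral_congr_ae ?_
  filter_upwards [compl_mem_ae_iff.mpr volume_blochSphere_eq_zero] with d hd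
  simp only [Set.mem_compl_iff, Set.mem_setOf_eq] at hd
  simp only [hSdef, hTdef, Set.preimage_setOf_eq]
  exact fibre_ratio hX d hd

end Notation

/-- **Two-qubit separability probability `8/33`** (Huong–Khoi 2024; Zhang–Jiang–Xie 2025,
Theorem 6.12): with respect to the Hilbert–Schmidt (= entry Lebesgue) volume on the affine space
of unit-trace Hermitian `4 × 4` matrices, `33 · vol{ρ ≽ 0, ρ^Γ ≽ 0} = 8 · vol{ρ ≽ 0}`, i.e. the
PPT (= separable, Peres–Horodecki) two-qubit states have relative volume `8/33` — the discharge of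
the named fact `HuongKhoi2024_qubit_separability_probability`. Proof as printed in
[ZhangJiangXie2025, Thm. 6.12]: the ratio equals the central-fibre ratio
(`HuongKhoi2024_qubit_separability_probability_of_fibre`, this file: Thm. 6.8, Props. 6.6, 6.9),
and the central-fibre ratio is `8/33`
(`ZhangJiangXie2025_qubit_fibre_separability_probability_holds`, sibling file
`TwoQubitSeparabilityVolumesQubitFibreProofs.lean`: Props. 6.7, 6.10).
[cite: ZhangJiangXie2025, Theorem 6.12] [cite: HuongKhoi2024, main theorem] -/
theorem HuongKhoi2024_qubit_separability_probability_holds :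
    HuongKhoi2024_qubit_separability_probability :=
  HuongKhoi2024_qubit_separability_probability_of_fibre
    ZhangJiangXie2025_qubit_fibre_separability_probability_holds

end Literature.Probability.RandomMatrix

end
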